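import Mathlib
import Literature.Analysis.FluidPDE.Tao2016AveragedNS.SelfSimilarCascadeBlowup
import Literature.Analysis.FluidPDE.Tao2016AveragedNS.WeightedLatticeFlows
import Summits.NavierStokesRegularity.NavierStokesRegularity.Theorems.TaoLadderRungTwoBreakBlowupRigidityOneMaximalExactFlow
import Summits.NavierStokesRegularity.NavierStokesRegularity.Theorems.TaoLadderRungTwoBreakBlowupRigidityOneCriticalLinearisation
import HarnessLib

/-!
# A Beale–Kato–Majda-type continuation criterion for the exact cascade lattice, part 2/2 (GRÖNWALL and
  the BLOW-UP OF THE CRITICAL AMPLITUDE along the maximal exact flow of a robustly blowing-up table) —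
  support for the extraction stub `stub_eternalFromBlowup` of K2(1) `TaoLadderRungTwoBreak.BlowupRigidityOne`
  (stmt-NavierStokesRegularity-20206)

MODEL lattice ODEs only (Tao 2016 §4, the exact cascade (4.12)); nothing here is a statement about the
Navier–Stokes equations; NO item is closed (`--supports stmt-NavierStokesRegularity-20206`). Route-independent.

* `weight45_bound_of_critical_bound` — GRÖNWALL: an exact flow on `[0,T)` (derivatives within `[0,∞)`),
  (4.5)-regular on every `[0,T']`, `T' < T`, whose critical amplitudes stay bounded
  (`(1+ε₀)^{5k/2}|X_{i,k}(t)| ≤ L` on `[0,T)`) keeps its (4.5) norm bounded UNIFORMLY up to `T`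
  (`≤ N(0)·e^{KT}`, `K = m² M_α L (3+(1+ε₀)^{10})`, by the linearisation estimate
  `weight45_mul_abs_quadTerm_le` of part 1 and Grönwall in the Dini form
  `le_gronwallBound_of_liminf_deriv_right_le` for the supremum `N(t)` over the countably many modes,
  which is Lipschitz on compact sub-intervals by the a priori bound);
* `critical_unbounded_of_maximalExactFlow` / `criticalBlowup_of_noGlobalCascade` — hence along the
  maximal exact flow of a robustly blowing-up `E₂(R)` table (`maximalExactFlow_of_noGlobalCascade`) the
  critical amplitude `sup_{i,k} Λ^k|X_{i,k}(t)|` is unbounded on `[0,T⋆)`: the blow-up delivered by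
  `NoGlobalCascade` is a blow-up IN THE TYPE-I QUANTITY of the K2 extraction, whatever admissible weight
  detected it. (Type I itself — `Λ^k(T⋆-t)|X_k(t)| ≤ C` — is the open step N-39 and is NOT claimed.)
-/

noncomputable section

-- the summit and its single sub-problem share the name (CONVENTIONS §1)
set_option linter.dupNamespace false

open Set Filter Topology Finset

namespace Summit.NavierStokesRegularity.NavierStokesRegularity.Theorems

namespace BlowupRigidityOne

open Literature.Analysis.FluidPDE Literature.Analysis.FluidPDE.TaoCascade

variable {m : ℕ}

/-! ### Grönwall: bounded critical amplitudes keep the (4.5) norm bounded -/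

/-- **BKM-TYPE CONTINUATION CRITERION.** Structure constants bounded by `M_α`, `ε₀ ≥ 0`. Let `X` solve
the exact lattice `∂ₜX_{i,k} = quadTerm_{i,k}(X)` on `[0,T)` (derivatives within `[0,∞)`), be
(4.5)-regular on every `[0,T']`, `T' < T`, and have BOUNDED CRITICAL AMPLITUDES
`(1+ε₀)^{5k/2}|X_{i,k}(t)| ≤ L` on `[0,T)`. Then its (4.5) norm is bounded UNIFORMLY on `[0,T)` (by
`N(0)e^{KT}`, `N(0) = sup_{i,k}(1+(1+ε₀)^{10k})|X_{i,k}(0)|`, `K = m²M_αL(3+(1+ε₀)^{10})`): Grönwall for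
the supremum `N(t)` (Lipschitz on every `[0,t]` by the a priori bound and the linearisation estimate,
right Dini derivative `≤ K N(t)`). [cite: Teschl2012, §2.6 (continuation of solutions) with Tao2016AveragedNS, §4 (4.8), (4.12)] -/
theorem weight45_bound_of_critical_bound {ε₀ Mα L T : ℝ} (hε : 0 ≤ ε₀) (hMα : 0 ≤ Mα) (hL : 0 ≤ L)
    {α : Fin m → Fin m → Fin m → ℤ × ℤ × ℤ → ℝ} (hα : ∀ i₁ i₂ i₃ μ, |α i₁ i₂ i₃ μ| ≤ Mα)
    {X : Fin m → ℤ → ℝ → ℝ}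
    (hder : ∀ i k, ∀ t ∈ Ico 0 T, HasDerivWithinAt (X i k) (quadTerm ε₀ α X i k t) (Ici 0) t)
    (hreg : ∀ T' : ℝ, T' < T → ∃ M : ℝ, ∀ t ∈ Icc 0 T', ∀ (i : Fin m) (k : ℤ),
      (1 + (1 + ε₀) ^ ((10 : ℝ) * k)) * |X i k t| ≤ M)
    (hLip : ∀ t ∈ Ico 0 T, ∀ (i : Fin m) (k : ℤ), (1 + ε₀) ^ ((5 : ℝ) * k / 2) * |X i k t| ≤ L) :
    ∃ M : ℝ, ∀ t ∈ Ico 0 T, ∀ (i : Fin m) (k : ℤ),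
      (1 + (1 + ε₀) ^ ((10 : ℝ) * k)) * |X i k t| ≤ M := by
  rcases isEmpty_or_nonempty (Fin m) with hm | hm
  · exact ⟨0, fun t _ i => (hm.false i).elim⟩
  set K : ℝ := (m : ℝ) ^ 2 * Mα * L * (3 + (1 + ε₀) ^ (10 : ℝ)) with hKdef
  have hl0 : (0 : ℝ) < 1 + ε₀ := by linarith
  have hK0 : 0 ≤ K := by positivity
  set W : ℤ → ℝ := fun k => 1 + (1 + ε₀) ^ ((10 : ℝ) * k) with hWdef
  have hW0 : ∀ k, 0 < W k := fun k => by
    have := Real.rpow_nonneg hl0.le ((10 : ℝ) * k); simp only [hWdef]; linarith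
  have hWabs : ∀ j k s, W k * |X j k s| = |W k * X j k s| := fun j k s => by
    rw [abs_mul, abs_of_pos (hW0 k)]
  -- the supremum over the modes
  set N : ℝ → ℝ := fun s => ⨆ p : Fin m × ℤ, W p.2 * |X p.1 p.2 s| with hNdef
  refine ⟨N 0 * Real.exp (K * T), fun t ht i k => ?_⟩
  -- everything below lives on `[0, t]`, `t < T`
  obtain ⟨M', hM'⟩ := hreg t ht.2
  have hbdd : ∀ s ∈ Icc (0 : ℝ) t, BddAbove (Set.range fun p : Fin m × ℤ => W p.2 * |X p.1 p.2 s|) :=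
    fun s hs => ⟨M', by rintro _ ⟨p, rfl⟩; exact hM' s hs p.1 p.2⟩
  have hleN : ∀ s ∈ Icc (0 : ℝ) t, ∀ (j : Fin m) (k : ℤ), W k * |X j k s| ≤ N s :=
    fun s hs j k => le_ciSup (hbdd s hs) (j, k)
  have hNle : ∀ s ∈ Icc (0 : ℝ) t, N s ≤ M' := fun s hs => ciSup_le fun p => hM' s hs p.1 p.2
  have hN0 : ∀ s ∈ Icc (0 : ℝ) t, 0 ≤ N s := fun s hs =>
    le_trans (mul_nonneg (hW0 0).le (abs_nonneg (X (Classical.arbitrary (Fin m)) 0 s)))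
      (hleN s hs _ 0)
  -- the linearisation estimate along the flow: `W_k |Ẋ_{j,k}(s)| ≤ K N(s)` on `[0,t]`
  have hqN : ∀ s ∈ Icc (0 : ℝ) t, ∀ (j : Fin m) (k : ℤ),
      W k * |quadTerm ε₀ α X j k s| ≤ K * N s := fun s hs j k =>
    weight45_mul_abs_quadTerm_le hε hMα hL (hN0 s hs) hα
      (fun j' k' => hLip s ⟨hs.1, lt_of_le_of_lt hs.2 ht.2⟩ j' k') (fun j' k' => hleN s hs j' k') j k
  -- mean value on `[a,b] ⊆ [0,t]`
  have hMVT : ∀ a b C : ℝ, 0 ≤ a → a ≤ b → b ≤ t →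
      (∀ τ ∈ Ico a b, ∀ (j : Fin m) (k : ℤ), W k * |quadTerm ε₀ α X j k τ| ≤ C) →
      ∀ (j : Fin m) (k : ℤ), |W k * X j k b - W k * X j k a| ≤ C * (b - a) := by
    intro a b C ha hab hbt hC j k
    have hd : ∀ τ ∈ Icc a b, HasDerivWithinAt (fun τ => W k * X j k τ)
        (W k * quadTerm ε₀ α X j k τ) (Icc a b) τ := by
      intro τ hτ
      exact ((hder j k τ ⟨ha.trans hτ.1, lt_of_le_of_lt (hτ.2.trans hbt) ht.2⟩).mono
        (fun x hx => ha.trans hx.1)).const_mul (W k)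
    have key := norm_image_sub_le_of_norm_deriv_le_segment' hd (fun τ hτ => by
      rw [Real.norm_eq_abs, abs_mul, abs_of_pos (hW0 k)]; exact hC τ hτ j k) b (right_mem_Icc.2 hab)
    simpa only [Real.norm_eq_abs] using key
  -- equi-Lipschitz modes ⇒ `N` is Lipschitz on `[0,t]`
  have hNlip : ∀ a b : ℝ, 0 ≤ a → a ≤ b → b ≤ t → |N b - N a| ≤ K * M' * (b - a) := by
    intro a b ha hab hbt
    have ha' : a ∈ Icc (0 : ℝ) t := ⟨ha, hab.trans hbt⟩
    have hb' : b ∈ Icc (0 : ℝ) t := ⟨ha.trans hab, hbt⟩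
    have hcomp := hMVT a b (K * M') ha hab hbt (fun τ hτ j k =>
      (hqN τ ⟨ha.trans hτ.1, hτ.2.le.trans hbt⟩ j k).trans
        (mul_le_mul_of_nonneg_left (hNle τ ⟨ha.trans hτ.1, hτ.2.le.trans hbt⟩) hK0))
    rw [abs_le]
    constructor
    · have : N a ≤ N b + K * M' * (b - a) := ciSup_le fun p => by
        have h1 := hcomp p.1 p.2
        have h2 := hleN b hb' p.1 p.2
        rw [hWabs] at h2 ⊢
        linarith [abs_sub_abs_le_abs_sub (W p.2 * X p.1 p.2 a) (W p.2 * X p.1 p.2 b),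
          abs_sub_comm (W p.2 * X p.1 p.2 a) (W p.2 * X p.1 p.2 b)]
      linarith
    · have : N b ≤ N a + K * M' * (b - a) := ciSup_le fun p => by
        have h1 := hcomp p.1 p.2
        have h2 := hleN a ha' p.1 p.2
        rw [hWabs] at h2 ⊢
        linarith [abs_sub_abs_le_abs_sub (W p.2 * X p.1 p.2 b) (W p.2 * X p.1 p.2 a)]
      linarith
  have hNlip' : ∀ a ∈ Icc (0 : ℝ) t, ∀ b ∈ Icc (0 : ℝ) t, |N a - N b| ≤ K * M' * |a - b| := by
    intro a ha b hb
    rcases le_total a b with hab | hba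
    · rw [abs_sub_comm, abs_of_nonpos (by linarith : a - b ≤ 0), neg_sub]
      exact hNlip a b ha.1 hab hb.2
    · rw [abs_of_nonneg (by linarith : 0 ≤ a - b)]
      exact hNlip b a hb.1 hba ha.2
  have hNcont : ContinuousOn N (Icc 0 t) := by
    rw [Metric.continuousOn_iff]
    intro b hb ε hεp
    refine ⟨ε / (K * M' + 1), div_pos hεp (by nlinarith [hN0 b hb, hNle b hb]), fun a ha hab => ?_⟩
    have hKM : 0 ≤ K * M' := mul_nonneg hK0 ((hN0 b hb).trans (hNle b hb))
    rw [Real.dist_eq] at hab ⊢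
    calc |N a - N b| ≤ K * M' * |a - b| := hNlip' a ha b hb
      _ ≤ (K * M' + 1) * |a - b| := mul_le_mul_of_nonneg_right (by linarith) (abs_nonneg _)
      _ < (K * M' + 1) * (ε / (K * M' + 1)) := mul_lt_mul_of_pos_left hab (by linarith)
      _ = ε := by field_simp
  -- the right Dini derivative of `N` is at most `K N`
  have hDini : ∀ x ∈ Ico (0 : ℝ) t, ∀ r : ℝ, K * N x < r →
      ∃ᶠ z in 𝓝[>] x, (z - x)⁻¹ * (N z - N x) < r := by
    intro x hx r hr
    set r' : ℝ := (K * N x + r) / 2 with hr'def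
    have hr'1 : K * N x < r' := by rw [hr'def]; linarith
    have hr'2 : r' < r := by rw [hr'def]; linarith
    set η : ℝ := (r' - K * N x) / (K + 1) with hηdef
    have hη : 0 < η := div_pos (by linarith) (by linarith)
    have hKη : K * η ≤ r' - K * N x := by
      rw [hηdef, mul_div_assoc']
      rw [div_le_iff₀ (by linarith : (0 : ℝ) < K + 1)]
      nlinarith
    have hcx : ContinuousWithinAt N (Icc 0 t) x := hNcont x ⟨hx.1, hx.2.le⟩
    rw [Metric.continuousWithinAt_iff] at hcx
    obtain ⟨δ, hδ, hδN⟩ := hcx η hη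
    have hev : ∀ᶠ z in 𝓝[>] x, z ∈ Ioo x (min t (x + δ)) :=
      Ioo_mem_nhdsGT (lt_min hx.2 (by linarith))
    refine (hev.mono fun z hz => ?_).frequently
    obtain ⟨hxz, hz⟩ := hz
    have hzt : z ≤ t := (lt_of_lt_of_le hz (min_le_left _ _)).le
    have hzδ : z < x + δ := lt_of_lt_of_le hz (min_le_right _ _)
    -- on `[x, z)` the derivative bound is `r'`
    have hC : ∀ τ ∈ Ico x z, ∀ (j : Fin m) (k : ℤ), W k * |quadTerm ε₀ α X j k τ| ≤ r' := by
      intro τ hτ j k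
      have hτt : τ ∈ Icc (0 : ℝ) t := ⟨hx.1.trans hτ.1, hτ.2.le.trans hzt⟩
      have hdist : dist τ x < δ := by
        rw [Real.dist_eq, abs_of_nonneg (by linarith [hτ.1])]; linarith [hτ.2]
      have hNτ : N τ < N x + η := by
        have h := hδN hτt hdist
        rw [Real.dist_eq] at h
        linarith [(abs_lt.1 h).2]
      calc W k * |quadTerm ε₀ α X j k τ| ≤ K * N τ := hqN τ hτt j k
        _ ≤ K * (N x + η) := mul_le_mul_of_nonneg_left hNτ.le hK0
        _ ≤ r' := by linarith [hKη]
    have hcompz := hMVT x z r' hx.1 hxz.le hzt hC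
    have hNz : N z ≤ N x + r' * (z - x) := ciSup_le fun p => by
      have h1 := hcompz p.1 p.2
      have h2 := hleN x ⟨hx.1, hx.2.le⟩ p.1 p.2
      rw [hWabs] at h2 ⊢
      linarith [abs_sub_abs_le_abs_sub (W p.2 * X p.1 p.2 z) (W p.2 * X p.1 p.2 x)]
    have hzx : 0 < z - x := sub_pos.2 hxz
    calc (z - x)⁻¹ * (N z - N x) ≤ (z - x)⁻¹ * (r' * (z - x)) :=
          mul_le_mul_of_nonneg_left (by linarith) (inv_nonneg.2 hzx.le)
      _ = r' := by field_simp
      _ < r := hr'2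
  -- Grönwall
  have hG := le_gronwallBound_of_liminf_deriv_right_le (f := N) (f' := fun x => K * N x)
    (δ := N 0) (K := K) (ε := 0) (a := 0) (b := t) hNcont hDini le_rfl
    (fun x _ => by simp only [add_zero, le_refl])
  have hNt : N t ≤ N 0 * Real.exp (K * t) := by
    have h := hG t ⟨ht.1, le_rfl⟩
    rwa [gronwallBound_ε0, sub_zero] at h
  have hexp : Real.exp (K * t) ≤ Real.exp (K * T) :=
    Real.exp_le_exp.2 (mul_le_mul_of_nonneg_left ht.2.le hK0)
  calc (1 + (1 + ε₀) ^ ((10 : ℝ) * k)) * |X i k t| = W k * |X i k t| := rfl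
    _ ≤ N t := hleN t ⟨ht.1, le_rfl⟩ i k
    _ ≤ N 0 * Real.exp (K * t) := hNt
    _ ≤ N 0 * Real.exp (K * T) := mul_le_mul_of_nonneg_left hexp (hN0 0 ⟨le_rfl, ht.1⟩)

/-! ### The critical amplitude blows up along the maximal exact flow -/

/-- **BKM along a maximal exact flow.** In the situation delivered by
`maximalExactFlow_of_noGlobalCascade` — an exact flow on `[0,T)`, `C¹` there, (4.5)-regular on every
`[0,T']`, `T' < T`, with (4.5) norm UNBOUNDED on `[0,T)` — the critical amplitude
`sup_{i,k}(1+ε₀)^{5k/2}|X_{i,k}(t)|` is unbounded on `[0,T)` (structure constants bounded by `M_α`).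
[cite: Teschl2012, §2.6; Tao2016AveragedNS, §4 (4.8), (4.12)] -/
theorem critical_unbounded_of_maximalExactFlow {ε₀ Mα T : ℝ} (hε : 0 ≤ ε₀) (hMα : 0 ≤ Mα)
    {α : Fin m → Fin m → Fin m → ℤ × ℤ × ℤ → ℝ} (hα : ∀ i₁ i₂ i₃ μ, |α i₁ i₂ i₃ μ| ≤ Mα)
    {X : Fin m → ℤ → ℝ → ℝ}
    (hC1 : ∀ i n, ContDiffOn ℝ 1 (X i n) (Set.Ico 0 T))
    (hmot : ∀ i n t, 0 ≤ t → t < T → derivWithin (X i n) (Set.Ici 0) t = quadTerm ε₀ α X i n t)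
    (hreg : ∀ T' : ℝ, 0 < T' → T' < T → ∃ M : ℝ, ∀ t : ℝ, 0 ≤ t → t ≤ T' →
      ∀ (i : Fin m) (n : ℤ), (1 + (1 + ε₀) ^ ((10 : ℝ) * n)) * |X i n t| ≤ M)
    (hunb : ∀ M : ℝ, ∃ t : ℝ, 0 ≤ t ∧ t < T ∧
      ∃ (i : Fin m) (n : ℤ), M < (1 + (1 + ε₀) ^ ((10 : ℝ) * n)) * |X i n t|) :
    ∀ L : ℝ, ∃ t : ℝ, 0 ≤ t ∧ t < T ∧
      ∃ (i : Fin m) (k : ℤ), L < (1 + ε₀) ^ ((5 : ℝ) * k / 2) * |X i k t| := by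
  intro L
  by_contra hcon
  push Not at hcon
  -- `hcon : ∀ t, 0 ≤ t → t < T → ∀ i k, (1+ε₀)^{5k/2}|X i k t| ≤ L`
  have hL : 0 ≤ L := by
    obtain ⟨t, ht0, htT, i, n, -⟩ := hunb 0
    exact le_trans (mul_nonneg (Real.rpow_nonneg (by linarith) _) (abs_nonneg _)) (hcon t ht0 htT i n)
  -- one-sided derivatives within `[0,∞)` from `C¹` on `[0,T)` and the motion law
  have hder : ∀ i k, ∀ t ∈ Ico (0 : ℝ) T,
      HasDerivWithinAt (X i k) (quadTerm ε₀ α X i k t) (Ici 0) t := by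
    intro i k t ht
    have hd : DifferentiableWithinAt ℝ (X i k) (Ico 0 T) t :=
      ((hC1 i k).differentiableOn one_ne_zero) t ht
    have hd' : DifferentiableWithinAt ℝ (X i k) (Ici 0) t :=
      hd.mono_of_mem_nhdsWithin (by
        rw [mem_nhdsWithin]
        exact ⟨Iio T, isOpen_Iio, ht.2, fun x hx => ⟨hx.2, hx.1⟩⟩)
    rw [← hmot i k t ht.1 ht.2]
    exact hd'.hasDerivWithinAt
  -- (4.5)-regularity on `[0,T']` for every `T' < T` (also `T' ≤ 0`)
  have hreg' : ∀ T' : ℝ, T' < T → ∃ M : ℝ, ∀ t ∈ Icc (0 : ℝ) T', ∀ (i : Fin m) (k : ℤ),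
      (1 + (1 + ε₀) ^ ((10 : ℝ) * k)) * |X i k t| ≤ M := by
    intro T' hT'
    rcases le_or_gt T' 0 with h0 | h0
    · -- `[0,T'] ⊆ {0}`: use any `T'' ∈ (0,T)` if `0 < T`, else the interval is degenerate anyway
      obtain ⟨t₀, ht₀0, ht₀T, -⟩ := hunb 0
      have hT0 : 0 < T := lt_of_le_of_lt ht₀0 ht₀T
      obtain ⟨M, hM⟩ := hreg (T / 2) (by linarith) (by linarith)
      exact ⟨M, fun t ht i k => hM t ht.1 (by linarith [ht.2]) i k⟩
    · obtain ⟨M, hM⟩ := hreg T' h0 hT'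
      exact ⟨M, fun t ht i k => hM t ht.1 ht.2 i k⟩
  obtain ⟨M, hM⟩ := weight45_bound_of_critical_bound hε hMα hL hα hder hreg'
    (fun t ht i k => hcon t ht.1 ht.2 i k)
  obtain ⟨t, ht0, htT, i, n, hlt⟩ := hunb M
  exact absurd (hM t ⟨ht0, htT⟩ i n) (not_le.2 hlt)

/-- **ROBUST BLOW-UP IS A BLOW-UP OF THE CRITICAL AMPLITUDE.** If `NoGlobalCascade ε₀ α X₀` (`ε₀ > 0`,
`α ∈ E₂(R)`, any `m`), then along the maximal exact cascade flow `X` from the one-shell datum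
(`maximalExactFlow_of_noGlobalCascade`: on `[0,T⋆)`, `C¹`, datum, no shells below `0`, exact motion,
(4.5)-regular before `T⋆`) the CRITICAL AMPLITUDE `sup_{i,k}(1+ε₀)^{5k/2}|X_{i,k}(t)| = sup_k Λ^k‖·‖` is
UNBOUNDED on `[0,T⋆)` — the quantity whose rate `Λ^k(T⋆-t)|X_k(t)| ≤ C` is the type-I clause of the K2
extraction (N-39, not claimed). [cite: Tao2016AveragedNS, §4 Thm. 4.2, (4.12); Teschl2012, §2.6] -/
theorem criticalBlowup_of_noGlobalCascade {ε₀ R : ℝ} (hε : 0 < ε₀)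
    {α : Fin m → Fin m → Fin m → ℤ × ℤ × ℤ → ℝ} {X₀ : Fin m → ℝ} (hα : InTableClass R α)
    (hNG : NoGlobalCascade ε₀ α X₀) :
    ∃ (T : ℝ) (X : Fin m → ℤ → ℝ → ℝ), 0 < T ∧
      (∀ i n, ContDiffOn ℝ 1 (X i n) (Set.Ico 0 T)) ∧
      (∀ i n, X i n 0 = if n = 0 then X₀ i else 0) ∧
      (∀ i n t, n < 0 → X i n t = 0) ∧
      (∀ i n t, 0 ≤ t → t < T → derivWithin (X i n) (Set.Ici 0) t = quadTerm ε₀ α X i n t) ∧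
      (∀ T' : ℝ, 0 < T' → T' < T → ∃ M : ℝ, ∀ t : ℝ, 0 ≤ t → t ≤ T' →
        ∀ (i : Fin m) (n : ℤ), (1 + (1 + ε₀) ^ ((10 : ℝ) * n)) * |X i n t| ≤ M) ∧
      (∀ L : ℝ, ∃ t : ℝ, 0 ≤ t ∧ t < T ∧
        ∃ (i : Fin m) (k : ℤ), L < (1 + ε₀) ^ ((5 : ℝ) * k / 2) * |X i k t|) := by
  obtain ⟨T, X, hT, h1, h2, h3, h4, h5, h6⟩ := maximalExactFlow_of_noGlobalCascade hε hα hNG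
  refine ⟨T, X, hT, h1, h2, h3, h4, h5, ?_⟩
  -- the motion only reads the table on the shift set: pass to the restricted table (bounded by `1`)
  have h4' : ∀ i n t, 0 ≤ t → t < T →
      derivWithin (X i n) (Set.Ici 0) t = quadTerm ε₀ (restrictShiftSet α) X i n t := by
    intro i n t ht htT; rw [quadTerm_restrictShiftSet]; exact h4 i n t ht htT
  exact critical_unbounded_of_maximalExactFlow hε.le zero_le_one
    (abs_restrictShiftSet_le zero_le_one (abs_le_one_of_inTableClass hα)) h1 h4' h5 h6

end BlowupRigidityOne

end Summit.NavierStokesRegularity.NavierStokesRegularity.Theorems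

end
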